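import Literature.Probability.LatticeModels.BrillouinRiemannSum
import HarnessLib

/-!
# Riemann sums over the momentum grid of the torus converge uniformly in a compact parameter

Topic `Probability/LatticeModels`; companion of `BrillouinRiemannSum.lean` (`cornerRiemannSum`,
`tendsto_cornerRiemannSum`: the non-parametric case) and `LatticeGreenRiemannSum.lean` (the grid
cells `gridCell j`, corners `cellCorner j = -π + (2π/L) j`, `cellCorner_add_centerIndex`).  For a
family `G(p, y)` jointly continuous on `[-π,π]^d × C`, `C` compact, the corner Riemann sums
`δ^d Σ_j G(c_j, y)` approximate `∫_{[-π,π]^d} G(·, y)` within any `ε > 0` for ALL `L ≥ L₀(ε)`,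
uniformly in `y ∈ C` (uniform continuity on the compact product — the standard "sums to integrals,
uniformly in the external momentum" step of finite-volume lattice perturbation theory,
Benfatto–Giuliani–Mastropietro 2006, eqs. (1.4), (2.4); Friedli–Velenik 2017, §10.5.2 (10.41)), and for a
`2π`-periodic integrand and even `L` the corner sum is the plain momentum sum
`Σ_{k ∈ (ℤ/Lℤ)^d} G(2πk/L, y)` (`sum_latticeMomentum_eq_sum_cellCorner`), whence the normalised
statement `momentumAverage_uniform_approx`:
`|L^{-d} Σ_k G(p_k, y) - (2π)^{-d} ∫_{[-π,π]^d} G(·,y)| ≤ ε` for all even `L ≥ L₀`, `y ∈ C`.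

## References

* G. Benfatto, A. Giuliani, V. Mastropietro, Ann. Henri Poincaré 7 (2006) 809, eqs. (1.4), (2.4).
  [BenfattoGiulianiMastropietro2006]
* S. Friedli, Y. Velenik, *Statistical Mechanics of Lattice Systems* (CUP 2017), §10.5.2, (10.41)
  («The reader can recognize a Riemann sum on the right-hand side …»). [FriedliVelenikSMLS2017]
  (DOCFIX 2026-08-19: earlier versions said Section 10.4 = the Chessboard Estimate — held text checked.)
* W. Rudin, *Principles of Mathematical Analysis*, 3rd ed., Thm. 7.9/6.8 (uniform continuity and
  Riemann sums). [Rudin1976]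
-/

noncomputable section

namespace Literature.Probability.LatticeModels

open MeasureTheory Filter Topology Finset Real

variable {d : ℕ} {E : Type*} [NormedAddCommGroup E] [NormedSpace ℝ E] [CompleteSpace E]
  {Y : Type*} [PseudoMetricSpace Y]

/-- **Corner Riemann sums converge uniformly in a compact parameter.** For `G` jointly
continuous on `[-π,π]^d × C` with `C` compact and `ε > 0` there is `L₀` such that
`‖δ^d Σ_j G(c_j, y) - ∫_{[-π,π]^d} G(·, y)‖ ≤ ε` for all `L ≥ L₀` and all `y ∈ C`. [cite: BenfattoGiulianiMastropietro2006, eqs. (1.4)  (2.4)] -/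
theorem cornerRiemannSum_uniform_approx {C : Set Y} (hC : IsCompact C)
    {G : (Fin d → ℝ) → Y → E}
    (hG : ContinuousOn (fun q : (Fin d → ℝ) × Y => G q.1 q.2) (brillouin d ×ˢ C))
    {ε : ℝ} (hε : 0 < ε) :
    ∃ L₀ : ℕ, ∀ (L : ℕ) [NeZero L], L₀ ≤ L → ∀ y ∈ C,
      ‖cornerRiemannSum (fun p => G p y) L - ∫ p in brillouin d, G p y‖ ≤ ε := by
  have hK : IsCompact (brillouin d ×ˢ C) := (isCompact_brillouin d).prod hC
  have huc : UniformContinuousOn (fun q : (Fin d → ℝ) × Y => G q.1 q.2) (brillouin d ×ˢ C) :=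
    hK.uniformContinuousOn_of_continuous hG
  have h2π : (0 : ℝ) < (2 * π) ^ d := by positivity
  set ε' : ℝ := ε / (2 * (2 * π) ^ d) with hε'
  have hε'pos : 0 < ε' := by positivity
  obtain ⟨η, hη, hηG⟩ := Metric.uniformContinuousOn_iff.1 huc ε' hε'pos
  obtain ⟨N, hN⟩ := exists_nat_gt (2 * π / η)
  refine ⟨max N 1, fun L _ hL y hy => ?_⟩
  have hL1 : 1 ≤ L := le_of_max_le_right hL
  have hLpos : (0 : ℝ) < L := by exact_mod_cast hL1
  have hδη : gridStep L < η := by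
    have hNL : (N : ℝ) ≤ L := by exact_mod_cast le_of_max_le_left hL
    unfold gridStep
    rw [div_lt_iff₀ hLpos]
    calc 2 * π = 2 * π / η * η := by field_simp
      _ < N * η := by gcongr
      _ ≤ L * η := by gcongr
      _ = η * L := mul_comm _ _
  -- the slice `G(·, y)` is continuous on the zone
  have hGy : ContinuousOn (fun p => G p y) (brillouin d) := by
    have h1 : ContinuousOn (fun p : Fin d → ℝ => (p, y)) (brillouin d) :=
      (continuousOn_id.prodMk continuousOn_const)
    exact hG.comp h1 fun p hp => Set.mk_mem_prod hp hy
  have hint : IntegrableOn (fun p => G p y) (brillouin d) volume :=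
    hGy.integrableOn_compact (isCompact_brillouin d)
  -- cellwise estimate
  have hcell : ∀ j : TorusSite d L,
      ‖(gridStep L) ^ d • G (cellCorner j) y - ∫ p in gridCell j, G p y‖ ≤ ε' * (gridStep L) ^ d := by
    intro j
    have hsub : gridCell j ⊆ brillouin d := gridCell_subset_brillouin j
    have hintj : IntegrableOn (fun p => G p y) (gridCell j) volume := hint.mono_set hsub
    have hvol : volume.real (gridCell j) = gridStep L ^ d := by
      rw [Measure.real, volume_gridCell_toReal]
    have hc : IntegrableOn (fun _ : Fin d → ℝ => G (cellCorner j) y) (gridCell j) volume :=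
      integrableOn_const (hs := (volume_gridCell_lt_top j).ne)
    rw [smul_eq_setIntegral_const j, ← integral_sub hc hintj, ← hvol]
    refine norm_setIntegral_le_of_norm_le_const (volume_gridCell_lt_top j) fun p hp => ?_
    rw [← dist_eq_norm, dist_comm]
    have hpq : dist ((p, y) : (Fin d → ℝ) × Y) (cellCorner j, y) < η := by
      rw [Prod.dist_eq, dist_self, max_eq_left dist_nonneg]
      exact (dist_cellCorner_le_of_mem_gridCell hp).trans_lt hδη
    exact (hηG (p, y) (Set.mk_mem_prod (hsub hp) hy) (cellCorner j, y)
      (Set.mk_mem_prod (hsub (cellCorner_mem_gridCell j)) hy) hpq).le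
  rw [cornerRiemannSum_eq, setIntegral_brillouin_eq_sum_gridCell' L hint, ← Finset.sum_sub_distrib]
  calc ‖∑ j : TorusSite d L, ((gridStep L) ^ d • G (cellCorner j) y - ∫ p in gridCell j, G p y)‖
      ≤ ∑ j : TorusSite d L, ‖(gridStep L) ^ d • G (cellCorner j) y - ∫ p in gridCell j, G p y‖ :=
        norm_sum_le _ _
    _ ≤ ∑ _j : TorusSite d L, ε' * (gridStep L) ^ d := Finset.sum_le_sum fun j _ => hcell j
    _ = ε' * (2 * π) ^ d := by
        rw [Finset.sum_const, Finset.card_univ, card_torusSite, nsmul_eq_mul, ← gridStep_mul L,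
          mul_pow]
        push_cast
        ring
    _ ≤ ε := by
        rw [hε']
        field_simp
        linarith

omit [NormedSpace ℝ E] [CompleteSpace E] in
/-- For a `2π`-periodic `G` and even `L`, the sum over the lattice momenta `2πk/L` equals the sum
over the cell corners `-π + 2πj/L` (shift `k ↦ k + (L/2,…,L/2)` and periodicity;
cf. `sum_greenIntegrand_latticeMomentum_eq`). [folklore] -/
theorem sum_latticeMomentum_eq_sum_cellCorner {L : ℕ} [NeZero L] (hL : Even L)
    {G : (Fin d → ℝ) → E} (hper : ∀ (p : Fin d → ℝ) (n : Fin d → ℤ),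
      G (fun i => p i + 2 * π * (n i : ℝ)) = G p) :
    ∑ k : TorusSite d L, G (latticeMomentum L k) = ∑ j : TorusSite d L, G (cellCorner j) := by
  have hterm : ∀ k : TorusSite d L, G (latticeMomentum L k) = G (cellCorner (k + centerIndex d L)) :=
    fun k => by
      obtain ⟨q, hq⟩ := cellCorner_add_centerIndex hL k
      rw [hq, hper]
  simp_rw [hterm]
  exact Equiv.sum_comp (Equiv.addRight (centerIndex d L)) fun j => G (cellCorner j)

/-- **Momentum averages converge to Brillouin-zone averages, uniformly in a compact parameter.**
For `G(p, y)` jointly continuous on `[-π,π]^d × C` (`C` compact) and `2π`-periodic in `p`, and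
`ε > 0`, there is `L₀` such that for all EVEN `L ≥ L₀` and all `y ∈ C`,
`‖L^{-d} Σ_{k ∈ (ℤ/Lℤ)^d} G(2πk/L, y) - (2π)^{-d} ∫_{[-π,π]^d} G(·, y)‖ ≤ ε`. [cite: BenfattoGiulianiMastropietro2006, eqs. (1.4)  (2.4)] -/
theorem momentumAverage_uniform_approx {C : Set Y} (hC : IsCompact C)
    {G : (Fin d → ℝ) → Y → E}
    (hG : ContinuousOn (fun q : (Fin d → ℝ) × Y => G q.1 q.2) (brillouin d ×ˢ C))
    (hper : ∀ (p : Fin d → ℝ) (y : Y) (n : Fin d → ℤ), G (fun i => p i + 2 * π * (n i : ℝ)) y = G p y)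
    {ε : ℝ} (hε : 0 < ε) :
    ∃ L₀ : ℕ, ∀ (L : ℕ) [NeZero L], L₀ ≤ L → Even L → ∀ y ∈ C,
      ‖((L ^ d : ℕ) : ℝ)⁻¹ • ∑ k : TorusSite d L, G (latticeMomentum L k) y -
          ((2 * π) ^ d)⁻¹ • ∫ p in brillouin d, G p y‖ ≤ ε := by
  have h2π : (0 : ℝ) < (2 * π) ^ d := by positivity
  obtain ⟨L₀, hL₀⟩ := cornerRiemannSum_uniform_approx hC hG (ε := (2 * π) ^ d * ε) (by positivity)
  refine ⟨L₀, fun L _ hL hev y hy => ?_⟩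
  have h := hL₀ L hL y hy
  have hLd : ((L ^ d : ℕ) : ℝ) ≠ 0 := by exact_mod_cast pow_ne_zero d (NeZero.ne L)
  -- `cornerRiemannSum = δ^d Σ_j G(c_j) = (2π)^d L^{-d} Σ_k G(p_k)`
  have hsum : ∑ k : TorusSite d L, G (latticeMomentum L k) y = ∑ j : TorusSite d L, G (cellCorner j) y :=
    sum_latticeMomentum_eq_sum_cellCorner hev (G := fun p => G p y) (fun p n => hper p y n)
  have hcs : cornerRiemannSum (fun p => G p y) L =
      (2 * π) ^ d • (((L ^ d : ℕ) : ℝ)⁻¹ • ∑ k : TorusSite d L, G (latticeMomentum L k) y) := by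
    rw [cornerRiemannSum_eq, ← Finset.smul_sum, hsum, smul_smul]
    congr 1
    have hL0 : (L : ℝ) ^ d ≠ 0 := pow_ne_zero d (by exact_mod_cast NeZero.ne L)
    rw [← gridStep_mul L, mul_pow]
    push_cast
    rw [mul_inv_cancel_right₀ hL0]
  have key : (2 * π) ^ d • (((L ^ d : ℕ) : ℝ)⁻¹ • ∑ k : TorusSite d L, G (latticeMomentum L k) y -
      ((2 * π) ^ d)⁻¹ • ∫ p in brillouin d, G p y) =
      cornerRiemannSum (fun p => G p y) L - ∫ p in brillouin d, G p y := by
    rw [smul_sub, hcs, ← mul_smul ((2 * π) ^ d) (((2 * π) ^ d)⁻¹), mul_inv_cancel₀ h2π.ne', one_smul]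
  have hn : ‖(2 * π) ^ d • (((L ^ d : ℕ) : ℝ)⁻¹ • ∑ k : TorusSite d L, G (latticeMomentum L k) y -
      ((2 * π) ^ d)⁻¹ • ∫ p in brillouin d, G p y)‖ ≤ (2 * π) ^ d * ε := by
    rw [key]; exact h
  rw [norm_smul, Real.norm_of_nonneg h2π.le] at hn
  exact le_of_mul_le_mul_left hn h2π

end Literature.Probability.LatticeModels

end
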